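import Mathlib
import Summits.RiemannHypothesis.RiemannHypothesis.Theorems.WeilFarFloorCoshTest
import HarnessLib

/-!
# The cosh quotient is positive: `R_c(a) ≥ 0.9·e^a − 14` for `a ≥ 3` (RH-free)

Helper file (`--supports stmt-RiemannHypothesis-0098`, lead-track anchor: Weil-positivity window ladder, format-C far bound),
pure proofs, RH-free, standard axioms.  Seat rh-explicit-weil-1 gen14 (memo
`run/shared/lean/pub/rh-explicit/rh-explicit-weil-1/FORMAT-K3.md` §15.7–15.8).

`FloorCosh.farCoercivityFloor_ge_coshTest` proves `9/10·e^a − 14 ≤ λ_max(a)` THROUGH the cosh quotient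
`R_c(a) = Q_a(C_a)/(a + sinh a)`, `C_a = 1_{[−a,a]}cosh(·/2)`, without exposing the intermediate bound.  This file exposes it
(`coshQuotient_ge_coshTest`, same computation: Mertens from below, Chebyshev from above for `ψ(e^{2a})`, Abel summation for the
weighted sum) and records `R_c(a) > 0` for `a ≥ 3` (`coshQuotient_pos`) — the positivity hypothesis of the second-order lower bound
`FloorSecondOrder.coshQuotient_add_secondOrder_le_farCoercivityFloor` (`WeilFarFloorSecondOrderLower`).  Nothing here bears on RH.
-/

set_option linter.dupNamespace false
set_option autoImplicit false

noncomputable section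

open MeasureTheory Set Filter
open scoped Real Topology ArithmeticFunction.vonMangoldt Chebyshev

namespace Summit.RiemannHypothesis.RiemannHypothesis.Theorems.WeilFormatC

namespace FloorSecondOrder

open Literature.NumberTheory.LFunctions

/-! ## The cosh quotient from below -/

/-- **The cosh quotient from below, RH-free**: `9/10·e^a − 14 ≤ R_c(a) = Q_a(C_a)/(a + sinh a)` for `a ≥ 3` (Mertens from below,
Chebyshev from above for `ψ(e^{2a})`, Abel summation for the weighted sum — the computation inside `FloorCosh.farCoercivityFloor_ge_coshTest`,
exposed at the level of the quotient). -/
theorem coshQuotient_ge_coshTest {a : ℝ} (ha : 3 ≤ a) :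
    9 / 10 * Real.exp a - 14
      ≤ primeShiftForm a ((Icc (-a) a).indicator (fun y ↦ Real.cosh (y / 2))) / (a + Real.sinh a) := by
  set A := Literature.NumberTheory.LFunctions.ChebyshevExplicit.A with hAdef
  have hA := Literature.NumberTheory.LFunctions.ChebyshevExplicit.A_bounds
  obtain ⟨hm, hb, hs⟩ := FloorCosh.coshTest_admissible a
  set χ := (Icc (-a) a).indicator (fun y ↦ Real.cosh (y / 2)) with hχ
  have ha0 : 0 ≤ a := by linarith
  obtain ⟨hE20, hElin⟩ := FloorCosh.exp_ge_of_three_le ha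
  set E := Real.exp a with hE
  have hEpos : 0 < E := Real.exp_pos a
  have hE2 : Real.exp (2 * a) = E ^ 2 := by rw [hE, ← Real.exp_nat_mul]; norm_num
  have hEinv : Real.exp (-a) * E = 1 := by rw [hE, ← Real.exp_add]; simp
  have hEinv0 : 0 < Real.exp (-a) := Real.exp_pos _
  have hEinv_le : Real.exp (-a) ≤ 1 / 20 := by
    rw [le_div_iff₀ (by norm_num : (0:ℝ) < 20)]; nlinarith
  -- the norm
  have hnorm : ∫ x, χ x ^ 2 = a + Real.sinh a := FloorCosh.integral_coshTest_sq ha0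
  have hsinh : Real.sinh a ≤ E / 2 := by rw [Real.sinh_eq]; linarith
  have hsinh0 : 0 ≤ Real.sinh a := Real.sinh_nonneg_iff.2 ha0
  have hpos : 0 < ∫ x, χ x ^ 2 := by rw [hnorm]; linarith
  rw [← hnorm, le_div_iff₀ hpos, hnorm, FloorCosh.primeShiftForm_coshTest a]
  -- the three Chebyshev-side sums
  set X := ⌊Real.exp (2 * a)⌋₊ with hX
  have hX1 : 1 ≤ Real.exp (2 * a) := Real.one_le_exp (by linarith)
  have hX30 : 30 ≤ Real.exp (2 * a) := by rw [hE2]; nlinarith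
  have hsplit : ∑ n ∈ Finset.Ioc 0 X, (Λ n : ℝ) * (E / n - Real.exp (-a) + (2 * a - Real.log n) * (1 + 1 / n) / 2)
      = E * (∑ n ∈ Finset.Ioc 0 X, (Λ n : ℝ) / n) - Real.exp (-a) * (∑ n ∈ Finset.Ioc 0 X, (Λ n : ℝ))
        + ∑ n ∈ Finset.Ioc 0 X, (Λ n : ℝ) * ((2 * a - Real.log n) * (1 + 1 / n) / 2) := by
    rw [Finset.mul_sum, Finset.mul_sum, ← Finset.sum_sub_distrib, ← Finset.sum_add_distrib]
    refine Finset.sum_congr rfl fun n _ ↦ ?_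
    ring
  rw [hsplit]
  -- (i) Mertens from below
  have hM : 2 * a - 4 ≤ ∑ n ∈ Finset.Ioc 0 X, (Λ n : ℝ) / n := by
    have h := FloorCosh.vonMangoldt_div_sum_ge hX1
    rwa [Real.log_exp] at h
  -- (ii) Chebyshev from above for `ψ(e^{2a})`
  have hψ : ∑ n ∈ Finset.Ioc 0 X, (Λ n : ℝ) ≤ 1106 / 1000 * E ^ 2 + 12 * a ^ 2 + 80 := by
    have hψX : ψ (Real.exp (2 * a)) = ∑ n ∈ Finset.Ioc 0 X, (Λ n : ℝ) := rfl
    rw [← hψX, Chebyshev.psi_eq_psi_coe_floor]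
    have h := Literature.NumberTheory.LFunctions.ChebyshevExplicit.psi_le_chebyshev ⌊Real.exp (2 * a)⌋₊
    have hfl1 : (1 : ℝ) ≤ (⌊Real.exp (2 * a)⌋₊ : ℝ) := by exact_mod_cast Nat.le_floor (by exact_mod_cast hX1)
    have hflX : (⌊Real.exp (2 * a)⌋₊ : ℝ) ≤ Real.exp (2 * a) := Nat.floor_le (by linarith)
    have hlog : Real.log (⌊Real.exp (2 * a)⌋₊ : ℝ) ≤ 2 * a := by
      have := Real.log_le_log (by linarith) hflX; rwa [Real.log_exp] at this
    have hlog0 : 0 ≤ Real.log (⌊Real.exp (2 * a)⌋₊ : ℝ) := Real.log_nonneg hfl1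
    have hsq : Real.log (⌊Real.exp (2 * a)⌋₊ : ℝ) ^ 2 ≤ (2 * a) ^ 2 := pow_le_pow_left₀ hlog0 hlog 2
    have hmain : 6 / 5 * A * (⌊Real.exp (2 * a)⌋₊ : ℝ) ≤ 1106 / 1000 * E ^ 2 :=
      (mul_le_mul_of_nonneg_right (by linarith [hA.2]) (by linarith)).trans
        (mul_le_mul_of_nonneg_left (hflX.trans hE2.le) (by norm_num))
    linarith
  -- (iii) the weighted sum via Abel + Chebyshev from below
  have hW : (A * E ^ 2 - 30 * A - A * (2 * a) - 5 / 2 * (2 * a) ^ 2) / 2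
      ≤ ∑ n ∈ Finset.Ioc 0 X, (Λ n : ℝ) * ((2 * a - Real.log n) * (1 + 1 / n) / 2) := by
    have hI := FloorCosh.integral_inv_mul_psi_ge hX30
    rw [← FloorCosh.sum_vonMangoldt_mul_log_div_eq_integral, Real.log_exp, ← hX, hE2] at hI
    have hdrop : ∑ n ∈ Finset.Icc 0 X, (2 * a - Real.log n) * (Λ n : ℝ)
        = ∑ n ∈ Finset.Ioc 0 X, (2 * a - Real.log n) * (Λ n : ℝ) := by
      rw [← Finset.sum_subset (Finset.Ioc_subset_Icc_self) fun n hn hn' ↦ by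
        have h0 : n = 0 := by rw [Finset.mem_Icc] at hn; rw [Finset.mem_Ioc] at hn'; omega
        subst h0; simp]
    rw [hdrop] at hI
    have hterm : ∀ n ∈ Finset.Ioc 0 X, (2 * a - Real.log n) * (Λ n : ℝ) / 2
        ≤ (Λ n : ℝ) * ((2 * a - Real.log n) * (1 + 1 / n) / 2) := by
      intro n hn
      rw [Finset.mem_Ioc] at hn
      have hn0 : (0 : ℝ) < n := by exact_mod_cast hn.1
      have hlog : Real.log n ≤ 2 * a := by
        rw [Real.log_le_iff_le_exp hn0]
        exact (Nat.cast_le.2 hn.2).trans (Nat.floor_le (Real.exp_pos _).le)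
      have hΛ : 0 ≤ (Λ n : ℝ) := ArithmeticFunction.vonMangoldt_nonneg
      have h1n : 0 ≤ 1 / (n : ℝ) := by positivity
      nlinarith [mul_nonneg hΛ (mul_nonneg (by linarith : 0 ≤ 2 * a - Real.log n) h1n)]
    calc (A * E ^ 2 - 30 * A - A * (2 * a) - 5 / 2 * (2 * a) ^ 2) / 2
        ≤ (∑ n ∈ Finset.Ioc 0 X, (2 * a - Real.log n) * (Λ n : ℝ)) / 2 := by linarith
      _ = ∑ n ∈ Finset.Ioc 0 X, (2 * a - Real.log n) * (Λ n : ℝ) / 2 := by rw [Finset.sum_div]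
      _ ≤ _ := Finset.sum_le_sum hterm
  -- assemble: (9/10·E − 14)(a + sinh a) ≤ E·M − e^{−a}·ψ + W
  have hfac : 0 ≤ 9 / 10 * E - 14 := by linarith
  have hT : (9 / 10 * E - 14) * (a + Real.sinh a) ≤ (9 / 10 * E - 14) * (a + E / 2) :=
    mul_le_mul_of_nonneg_left (by linarith) hfac
  refine hT.trans ?_
  have h1 : Real.exp (-a) * (1106 / 1000 * E ^ 2 + 12 * a ^ 2 + 80) ≤ 1106 / 1000 * E + (12 * a ^ 2 + 80) / 20 := by
    have : Real.exp (-a) * (1106 / 1000 * E ^ 2) = 1106 / 1000 * E := by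
      calc Real.exp (-a) * (1106 / 1000 * E ^ 2) = 1106 / 1000 * E * (Real.exp (-a) * E) := by ring
        _ = 1106 / 1000 * E := by rw [hEinv, mul_one]
    nlinarith [mul_le_mul_of_nonneg_right hEinv_le (by positivity : (0 : ℝ) ≤ 12 * a ^ 2 + 80)]
  have h2 : (11 / 10 * a + 1894 / 1000) * (20 * a - 40) ≤ (11 / 10 * a + 1894 / 1000) * E :=
    mul_le_mul_of_nonneg_left hElin (by linarith)
  have hMl : E * (2 * a - 4) ≤ E * ∑ n ∈ Finset.Ioc 0 X, (Λ n : ℝ) / n := mul_le_mul_of_nonneg_left hM hEpos.le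
  have hψl : Real.exp (-a) * (∑ n ∈ Finset.Ioc 0 X, (Λ n : ℝ)) ≤ Real.exp (-a) * (1106 / 1000 * E ^ 2 + 12 * a ^ 2 + 80) :=
    mul_le_mul_of_nonneg_left hψ hEinv0.le
  nlinarith [hMl, hψl, hW, h1, h2, hA.1, hA.2, sq_nonneg E, hE20]

/-- `R_c(b) > 0` for `b ≥ 3` (indeed `≥ 0.9e^b − 14 ≥ 4`). -/
theorem coshQuotient_pos {b : ℝ} (hb : 3 ≤ b) :
    0 < primeShiftForm b ((Icc (-b) b).indicator (fun y ↦ Real.cosh (y / 2))) / (b + Real.sinh b) := by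
  have h := coshQuotient_ge_coshTest hb
  obtain ⟨hE20, -⟩ := FloorCosh.exp_ge_of_three_le hb
  linarith

end FloorSecondOrder

end Summit.RiemannHypothesis.RiemannHypothesis.Theorems.WeilFormatC
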